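import Literature.Computability.Complexity.GateEliminationCase5Split

/-!
# Gate elimination: the main strategy of Case 5 (the chain `x := c`; eliminate `G`, `D`, `B`)

Li–Yang §4.1, Case 5: "Clearly, substituting appropriate constant to `x` (or `y`) will trivialize
`G`, further removing `B` (or `C`), `D` and `G` by normalization. If no troubled gates are
introduced during eliminating these three gates, we will obtain `Δμ = 3 + α_φ + α_I ≥ δ`."

This file sets up the chain as named elimination data (for the sub-case analyses of
Cases 5.2–5.4 to inspect): `case5b` (the constant trivializing `G`), `case5C₁ = C[x := b]`,
`case5E₁` (eliminate the trivialized `G`; no troubled gate can appear, `y` becoming a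
`1`-variable), `case5kD`/`case5E₂` (eliminate `D`, now fed by a constant), `case5kB`/`case5E₃`
(eliminate `B`, fed by the constant `x`), and proves the success criterion `case5_main`: if the
last two eliminations introduce no troubled gate then `Δμ ≥ 3 + α_φ + α_I ≥ δ` (the destroyed
troubled gate `G` pays `α_φ`).

## References

* J. Li, T. Yang, *3.1n − o(n) circuit lower bounds for explicit functions*, STOC 2022;
  ECCC TR21-023, §4.1 (Case 5), Lemma 3.11.
-/

namespace Literature.Computability.Complexity

open Finset

namespace Semicircuit

variable {n : ℕ} {C : Semicircuit n} {f : (Fin n → ZMod 2) → Bool} {R : RdqSource n} {d : ℕ}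
  {αφ αI αQ : ℝ} {G : Fin C.m} {x y : Fin n} {B C' D : Fin C.m} {aX aB aC aD : Fin 2}

/-- `δ ≤ α_I + 3 + α_φ`. [cite: LiYang2022, Lemma 3.11 / proof of Thm. 1.1] -/
theorem liYangDelta_le_three (αφ αI αQ : ℝ) : liYangDelta αφ αI αQ ≤ αI + (3 + αφ) := by
  unfold liYangDelta
  have h1 : min (αI / 3) (min (2 - 2 * αφ + αQ) (min (4 - 4 * αφ) (min (3 + αφ) (min (5 - αQ) ((5 - 2 * αφ + αQ) / 2))))) ≤
      min (2 - 2 * αφ + αQ) (min (4 - 4 * αφ) (min (3 + αφ) (min (5 - αQ) ((5 - 2 * αφ + αQ) / 2)))) := min_le_right _ _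
  have h2 : min (2 - 2 * αφ + αQ) (min (4 - 4 * αφ) (min (3 + αφ) (min (5 - αQ) ((5 - 2 * αφ + αQ) / 2)))) ≤
      min (4 - 4 * αφ) (min (3 + αφ) (min (5 - αQ) ((5 - 2 * αφ + αQ) / 2))) := min_le_right _ _
  have h3 : min (4 - 4 * αφ) (min (3 + αφ) (min (5 - αQ) ((5 - 2 * αφ + αQ) / 2))) ≤
      min (3 + αφ) (min (5 - αQ) ((5 - 2 * αφ + αQ) / 2)) := min_le_right _ _
  have h4 : min (3 + αφ) (min (5 - αQ) ((5 - 2 * αφ + αQ) / 2)) ≤ 3 + αφ := min_le_left _ _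
  linarith

section Chain

variable (hf : IsAffineDisperser f d) (hd : 2 * d + 2 < R.dim) (hF : C.Fair) (hC : C.ComputesRestr f R)
  (hS : C.Standing R) (hcfg : C.Case5Config G x y B C' D aX aB aC aD) (hφ : 0 ≤ αφ) (hI : 0 ≤ αI) (αQ : ℝ)

/-! #### Step 0: the constant substitution `x := b` trivializing `G` -/

/-- The constant trivializing `G` at `x`. [cite: LiYang2022, §4.1 (Case 5)] -/
noncomputable def case5b : Bool := (exists_trivializing hcfg.and_G aX).choose

/-- It trivializes `G`. [folklore] -/
theorem case5b_spec : C.liveFn G aX (case5b hcfg) false = C.liveFn G aX (case5b hcfg) true :=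
  (exists_trivializing hcfg.and_G aX).choose_spec

/-- The constant in `𝔽₂`. [folklore] -/
noncomputable def case5c : ZMod 2 := finTwoEquiv.symm (case5b hcfg)

/-- `finTwoEquiv (case5c) = case5b`. [folklore] -/
theorem finTwoEquiv_case5c : finTwoEquiv (case5c hcfg) = case5b hcfg := finTwoEquiv.apply_symm_apply _

include hC hcfg in
/-- `x` is free. [folklore] -/
theorem case5_free_x : R.Free x := free_of_reads hC hcfg.arg_G_x

include hS hcfg in
/-- `x` is unprotected (it feeds an ∧-type gate). [cite: LiYang2022, §4.1 (Case 1)] -/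
theorem case5_unprot_x : ¬ R.Protected x := fun hp => hS.protected_not_and x hp G aX hcfg.arg_G_x hcfg.and_G

include hS hcfg in
/-- `y` is unprotected. [cite: LiYang2022, §4.1 (Case 1)] -/
theorem case5_unprot_y : ¬ R.Protected y := fun hp => hS.protected_not_and y hp G aX.rev hcfg.arg_G_y hcfg.and_G

/-- The circuit after `x := b`. [cite: LiYang2022, §4.1 (Case 5)] -/
noncomputable abbrev case5C₁ : Semicircuit n := C.substConst x (finTwoEquiv (case5c hcfg))

/-- The source after `x := b`. [cite: LiYang2022, §2.4] -/
noncomputable abbrev case5R₁ : RdqSource n := R.assignFree x (case5c hcfg) (case5_free_x hC hcfg) (case5_unprot_x hS hcfg)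

/-- Wires after `x := b`. [folklore] -/
theorem case5C₁_arg (k : Fin C.m) (a : Fin 2) :
    (case5C₁ hcfg).arg k a = (C.arg k a).substConst x (finTwoEquiv (case5c hcfg)) := rfl

/-- A wire other than `x` is unchanged. [folklore] -/
theorem case5C₁_arg_of_ne {k : Fin C.m} {a : Fin 2} (h : C.arg k a ≠ .var x) :
    (case5C₁ hcfg).arg k a = C.arg k a := by
  rw [case5C₁_arg]
  cases hv : C.arg k a with
  | const b => rfl
  | var i =>
    rw [hv] at h
    exact Node.substConst_var_of_ne (fun hix : i = x => h (by rw [hix])) _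
  | gate g => rfl

/-- A wire to `x` becomes the constant. [folklore] -/
theorem case5C₁_arg_of_eq {k : Fin C.m} {a : Fin 2} (h : C.arg k a = .var x) :
    (case5C₁ hcfg).arg k a = .const (case5b hcfg) := by
  rw [case5C₁_arg, h, Node.substConst_var_self, finTwoEquiv_case5c]

/-- `G` reads the constant at `aX`. [folklore] -/
theorem case5C₁_arg_G : (case5C₁ hcfg).arg G aX = .const (case5b hcfg) := case5C₁_arg_of_eq hcfg hcfg.arg_G_x

/-- `G` still reads `y`. [folklore] -/
theorem case5C₁_arg_G_rev : (case5C₁ hcfg).arg G aX.rev = .var y := by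
  have h : C.arg G aX.rev ≠ .var x := by
    rw [hcfg.arg_G_y]; exact fun h => hcfg.x_ne_y.symm (Node.var.inj h)
  rw [case5C₁_arg_of_ne hcfg h, hcfg.arg_G_y]

/-- `G` is trivialized. [folklore] -/
theorem case5C₁_triv : (case5C₁ hcfg).liveFn G aX (case5b hcfg) false = (case5C₁ hcfg).liveFn G aX (case5b hcfg) true :=
  case5b_spec hcfg

include hf hd hF hC hS in
/-- The output is not `G`. [folklore] -/
theorem case5C₁_out_ne : (case5C₁ hcfg).out ≠ .gate G := by
  have hx := case5_free_x hC hcfg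
  have hxp := case5_unprot_x hS hcfg
  have hd₁ : 2 * d ≤ (case5R₁ hC hS hcfg).dim := by
    have := RdqSource.dim_assignFree (b := case5c hcfg) hx hxp
    change (R.assignFree x (case5c hcfg) hx hxp).dim + 1 = R.dim at this
    show 2 * d ≤ (R.assignFree x (case5c hcfg) hx hxp).dim
    omega
  exact out_ne_of_trivialized hf hd₁ (hF.substConst x _) (hC.substConst_assignFree hx hxp _) (case5C₁_arg_G hcfg)
    (case5C₁_triv hcfg)

include hC hS in
/-- The dimension after the substitution. [folklore] -/
theorem case5R₁_dim : 2 * d + 2 ≤ (case5R₁ hC hS hcfg).dim ↔ 2 * d + 2 < R.dim := by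
  have := RdqSource.dim_assignFree (b := case5c hcfg) (case5_free_x hC hcfg) (case5_unprot_x hS hcfg)
  change (R.assignFree x (case5c hcfg) _ _).dim + 1 = R.dim at this
  show 2 * d + 2 ≤ (R.assignFree x (case5c hcfg) _ _).dim ↔ _
  omega

/-! #### Step 1: eliminate `G` -/

/-- **Elimination of the trivialized `G`.** [cite: LiYang2022, §4.1 (Case 5), Lemma 3.11] -/
noncomputable def case5E₁ : ElimDataW (case5C₁ hcfg) G f (case5R₁ hC hS hcfg) αφ αI αQ
    (C.substConstPacking x (finTwoEquiv (case5c hcfg)) ∅) (1 - αφ) :=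
  elimDataWTriv (hF.substConst x _) (hC.substConst_assignFree _ _ _) (C.isPacking_empty.substConst)
    (case5C₁_arg_G hcfg) (case5C₁_triv hcfg) (case5C₁_out_ne hf hd hF hC hS hcfg) hφ hI αQ

/-- Its replacement node is a constant. [folklore] -/
theorem case5E₁_repl : (case5E₁ hf hd hF hC hS hcfg hφ hI αQ).repl = .const ((case5C₁ hcfg).liveFn G aX (case5b hcfg) false) := rfl

include hf hd hF hC in
/-- **Eliminating `G` introduces no troubled gate** (`y` becomes a `1`-variable, the other wire
is a constant). [cite: LiYang2022, §4.1 (Case 5), Lemma 3.11] -/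
theorem case5E₁_noNew (k' : Fin (case5E₁ hf hd hF hC hS hcfg hφ hI αQ).C'.m)
    (hT' : (case5E₁ hf hd hF hC hS hcfg hφ hI αQ).C'.Troubled k') : (case5C₁ hcfg).Troubled ((case5E₁ hf hd hF hC hS hcfg hφ hI αQ).ι k') := by
  by_contra hT
  obtain ⟨a, ha⟩ := (case5E₁ hf hd hF hC hS hcfg hφ hI αQ).causedBy_of_new_troubled k' hT' hT
  rcases fin2_eq_or_eq_rev aX a with h | h
  · rw [h, case5C₁_arg_G] at ha; exact not_causedBy_const ha
  · rw [h, case5C₁_arg_G_rev] at ha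
    rcases ha with ha | ⟨z, hz, a', ha'⟩
    · cases ha
    · cases hz
      -- `k'` reads `y`, whose out-degree is now `1`
      obtain ⟨-, -, x', y', -, hr, hx', hy'⟩ := hT'
      have hfan : (case5E₁ hf hd hF hC hS hcfg hφ hI αQ).C'.fanout (.var y) + 1 = 2 := by
        have h1 := (case5E₁ hf hd hF hC hS hcfg hφ hI αQ).fanout_var_add (i := y)
          (by rw [case5E₁_repl]; exact fun h => by cases h)
        have h2 : (univ.filter fun a : Fin 2 => (case5C₁ hcfg).arg G a = .var y).card = 1 := by
          rw [card_eq_one]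
          refine ⟨aX.rev, ?_⟩
          ext a₁
          rw [mem_filter, mem_singleton]
          constructor
          · intro h'
            rcases fin2_eq_or_eq_rev aX a₁ with e | e
            · have h'' := h'.2; rw [e, case5C₁_arg_G] at h''; cases h''
            · exact e
          · rintro rfl; exact ⟨mem_univ _, case5C₁_arg_G_rev hcfg⟩
        have h3 : (case5C₁ hcfg).fanout (.var y) = 2 := by
          rw [C.fanout_substConst_var_of_ne x _ (fun h => hcfg.x_ne_y h.symm)]; exact hcfg.fanout_y
        omega
      have hmem : (Node.var y : Node n _) ∈ Set.range ((case5E₁ hf hd hF hC hS hcfg hφ hI αQ).C'.arg k') := ⟨a', ha'⟩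
      rw [hr] at hmem
      rcases hmem with h' | h'
      · cases h'; omega
      · cases h'; omega

/-! #### Step 2: eliminate `D` (fed by the constant that replaced `G`) -/

include hS hcfg in
/-- `B ≠ D` (else `G` is useless). [cite: LiYang2022, §4.1 (Case 5)] -/
theorem case5_B_ne_D : B ≠ D := by
  intro h
  refine hS.normalized.2 G ⟨hcfg.fanout_G, D, aD, aX, hcfg.D_ne_G.symm, hcfg.arg_D, ?_⟩
  rcases fin2_eq_or_eq_rev aD aB with e | e
  · have := hcfg.arg_B; rw [h, e, hcfg.arg_D] at this; cases this
  · have := hcfg.arg_B; rw [h, e] at this; rw [this, hcfg.arg_G_x]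

include hS hcfg in
/-- `C' ≠ D` (else `G` is useless). [cite: LiYang2022, §4.1 (Case 5)] -/
theorem case5_C_ne_D : C' ≠ D := by
  intro h
  refine hS.normalized.2 G ⟨hcfg.fanout_G, D, aD, aX.rev, hcfg.D_ne_G.symm, hcfg.arg_D, ?_⟩
  rcases fin2_eq_or_eq_rev aD aC with e | e
  · have := hcfg.arg_C; rw [h, e, hcfg.arg_D] at this; cases this
  · have := hcfg.arg_C; rw [h, e] at this; rw [this, hcfg.arg_G_y]

include hS hcfg in
/-- `D` does not read `x` (else `G` is useless). [cite: LiYang2022, §4.1 (Case 5)] -/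
theorem case5_D_not_x (a : Fin 2) : C.arg D a ≠ .var x := by
  intro h
  have ha : a = aD.rev := by
    rcases fin2_eq_or_eq_rev aD a with e | e
    · rw [e, hcfg.arg_D] at h; cases h
    · exact e
  refine hS.normalized.2 G ⟨hcfg.fanout_G, D, aD, aX, hcfg.D_ne_G.symm, hcfg.arg_D, ?_⟩
  rw [← ha, h, hcfg.arg_G_x]

include hS hcfg in
/-- `D` does not read `y` (else `G` is useless). [cite: LiYang2022, §4.1 (Case 5)] -/
theorem case5_D_not_y (a : Fin 2) : C.arg D a ≠ .var y := by
  intro h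
  have ha : a = aD.rev := by
    rcases fin2_eq_or_eq_rev aD a with e | e
    · rw [e, hcfg.arg_D] at h; cases h
    · exact e
  refine hS.normalized.2 G ⟨hcfg.fanout_G, D, aD, aX.rev, hcfg.D_ne_G.symm, hcfg.arg_D, ?_⟩
  rw [← ha, h, hcfg.arg_G_y]

/-- The gate `D` in the circuit after the elimination of `G`. [folklore] -/
noncomputable def case5kD : Fin (case5E₁ hf hd hF hC hS hcfg hφ hI αQ).C'.m :=
  ((case5E₁ hf hd hF hC hS hcfg hφ hI αQ).ι_surj D hcfg.D_ne_G).choose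

/-- It is `D`. [folklore] -/
theorem case5kD_spec : (case5E₁ hf hd hF hC hS hcfg hφ hI αQ).ι (case5kD hf hd hF hC hS hcfg hφ hI αQ) = D :=
  ((case5E₁ hf hd hF hC hS hcfg hφ hI αQ).ι_surj D hcfg.D_ne_G).choose_spec

/-- `D` now reads a constant at `aD`. [folklore] -/
theorem case5_arg_kD : (case5E₁ hf hd hF hC hS hcfg hφ hI αQ).C'.arg (case5kD hf hd hF hC hS hcfg hφ hI αQ) aD =
    .const ((case5C₁ hcfg).liveFn G aX (case5b hcfg) false) := by
  rw [(case5E₁ hf hd hF hC hS hcfg hφ hI αQ).arg_eq_const_iff]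
  refine Or.inr ⟨?_, case5E₁_repl hf hd hF hC hS hcfg hφ hI αQ⟩
  rw [case5kD_spec, case5C₁_arg]
  rw [hcfg.arg_D]; rfl

/-- **Elimination of `D`.** [cite: LiYang2022, §4.1 (Case 5), Lemma 3.11] -/
noncomputable def case5E₂ : ElimDataW (case5E₁ hf hd hF hC hS hcfg hφ hI αQ).C' (case5kD hf hd hF hC hS hcfg hφ hI αQ) f
    (case5R₁ hC hS hcfg) αφ αI αQ (case5E₁ hf hd hF hC hS hcfg hφ hI αQ).P' (1 - αφ) :=
  elimDataWConstFed hf ((case5R₁_dim hC hS hcfg).mpr hd) (case5E₁ hf hd hF hC hS hcfg hφ hI αQ).fair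
    (case5E₁ hf hd hF hC hS hcfg hφ hI αQ).computes (case5E₁ hf hd hF hC hS hcfg hφ hI αQ).packing
    (case5_arg_kD hf hd hF hC hS hcfg hφ hI αQ) hφ hI αQ

/-! #### Step 3: eliminate `B` (fed by the constant `x`) -/

/-- The gate `B` after the elimination of `G`. [folklore] -/
noncomputable def case5kB₁ : Fin (case5E₁ hf hd hF hC hS hcfg hφ hI αQ).C'.m :=
  ((case5E₁ hf hd hF hC hS hcfg hφ hI αQ).ι_surj B hcfg.B_ne_G).choose

/-- It is `B`. [folklore] -/
theorem case5kB₁_spec : (case5E₁ hf hd hF hC hS hcfg hφ hI αQ).ι (case5kB₁ hf hd hF hC hS hcfg hφ hI αQ) = B :=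
  ((case5E₁ hf hd hF hC hS hcfg hφ hI αQ).ι_surj B hcfg.B_ne_G).choose_spec

/-- `B ≠ D` after the elimination of `G`. [folklore] -/
theorem case5kB₁_ne : case5kB₁ hf hd hF hC hS hcfg hφ hI αQ ≠ case5kD hf hd hF hC hS hcfg hφ hI αQ := by
  intro h
  have := congrArg (case5E₁ hf hd hF hC hS hcfg hφ hI αQ).ι h
  rw [case5kB₁_spec, case5kD_spec] at this
  exact case5_B_ne_D hS hcfg this

/-- The gate `B` after the eliminations of `G` and `D`. [folklore] -/
noncomputable def case5kB : Fin (case5E₂ hf hd hF hC hS hcfg hφ hI αQ).C'.m :=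
  ((case5E₂ hf hd hF hC hS hcfg hφ hI αQ).ι_surj _ (case5kB₁_ne hf hd hF hC hS hcfg hφ hI αQ)).choose

/-- It is `B`. [folklore] -/
theorem case5kB_spec : (case5E₂ hf hd hF hC hS hcfg hφ hI αQ).ι (case5kB hf hd hF hC hS hcfg hφ hI αQ) =
    case5kB₁ hf hd hF hC hS hcfg hφ hI αQ :=
  ((case5E₂ hf hd hF hC hS hcfg hφ hI αQ).ι_surj _ (case5kB₁_ne hf hd hF hC hS hcfg hφ hI αQ)).choose_spec

/-- `B` reads the constant `x` at `aB`, after the elimination of `G`. [folklore] -/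
theorem case5_arg_kB₁ : (case5E₁ hf hd hF hC hS hcfg hφ hI αQ).C'.arg (case5kB₁ hf hd hF hC hS hcfg hφ hI αQ) aB =
    .const (case5b hcfg) := by
  rw [(case5E₁ hf hd hF hC hS hcfg hφ hI αQ).arg_eq_const_iff]
  refine Or.inl ?_
  rw [case5kB₁_spec]
  exact case5C₁_arg_of_eq hcfg hcfg.arg_B

/-- `B` reads the constant `x` at `aB`, after the eliminations of `G` and `D`. [folklore] -/
theorem case5_arg_kB : (case5E₂ hf hd hF hC hS hcfg hφ hI αQ).C'.arg (case5kB hf hd hF hC hS hcfg hφ hI αQ) aB =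
    .const (case5b hcfg) := by
  rw [(case5E₂ hf hd hF hC hS hcfg hφ hI αQ).arg_eq_const_iff]
  refine Or.inl ?_
  rw [case5kB_spec]
  exact case5_arg_kB₁ hf hd hF hC hS hcfg hφ hI αQ

/-- **Elimination of `B`.** [cite: LiYang2022, §4.1 (Case 5), Lemma 3.11] -/
noncomputable def case5E₃ : ElimDataW (case5E₂ hf hd hF hC hS hcfg hφ hI αQ).C' (case5kB hf hd hF hC hS hcfg hφ hI αQ) f
    (case5R₁ hC hS hcfg) αφ αI αQ (case5E₂ hf hd hF hC hS hcfg hφ hI αQ).P' (1 - αφ) :=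
  elimDataWConstFed hf ((case5R₁_dim hC hS hcfg).mpr hd) (case5E₂ hf hd hF hC hS hcfg hφ hI αQ).fair
    (case5E₂ hf hd hF hC hS hcfg hφ hI αQ).computes (case5E₂ hf hd hF hC hS hcfg hφ hI αQ).packing
    (case5_arg_kB hf hd hF hC hS hcfg hφ hI αQ) hφ hI αQ

/-! #### Out-degree of `y` along the chain: gates reading `y` are never troubled -/

/-- After the elimination of `G`, `y` is a `1`-variable. [cite: LiYang2022, §4.1 (Case 5)] -/
theorem case5_fanout_y₁ : (case5E₁ hf hd hF hC hS hcfg hφ hI αQ).C'.fanout (.var y) = 1 := by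
  have h1 := (case5E₁ hf hd hF hC hS hcfg hφ hI αQ).fanout_var_add (i := y)
    (by rw [case5E₁_repl]; exact fun h => by cases h)
  have h2 : (univ.filter fun a : Fin 2 => (case5C₁ hcfg).arg G a = .var y).card = 1 := by
    rw [card_eq_one]
    refine ⟨aX.rev, ?_⟩
    ext a₁
    rw [mem_filter, mem_singleton]
    constructor
    · intro h'
      rcases fin2_eq_or_eq_rev aX a₁ with e | e
      · have h'' := h'.2; rw [e, case5C₁_arg_G] at h''; cases h''
      · exact e
    · rintro rfl; exact ⟨mem_univ _, case5C₁_arg_G_rev hcfg⟩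
  have h3 : (case5C₁ hcfg).fanout (.var y) = 2 := by
    rw [C.fanout_substConst_var_of_ne x _ (fun h => hcfg.x_ne_y h.symm)]; exact hcfg.fanout_y
  omega

include hS hcfg in
/-- `D` reads `G` only once. [folklore] -/
theorem case5_arg_D_rev_ne_G : C.arg D aD.rev ≠ .gate G := by
  intro h
  rcases fin2_eq_or_eq_rev 0 aD with e | e
  · exact hS.normalized.1.arg_zero_ne_arg_one D (by rw [← e, hcfg.arg_D, ← h, e]; rfl)
  · exact hS.normalized.1.arg_zero_ne_arg_one D (by
      have h1 : aD = 1 := by rw [e]; rfl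
      rw [← h1, hcfg.arg_D, ← h, h1]; rfl)

/-- The other wire of `D` after `x := b` and the elimination of `G`: the pull-back of the old
one. [folklore] -/
theorem case5_arg_kD_rev : (case5E₁ hf hd hF hC hS hcfg hφ hI αQ).C'.arg (case5kD hf hd hF hC hS hcfg hφ hI αQ) aD.rev =
    (case5E₁ hf hd hF hC hS hcfg hφ hI αQ).pull (C.arg D aD.rev) := by
  rw [(case5E₁ hf hd hF hC hS hcfg hφ hI αQ).arg_eq', case5kD_spec, case5C₁_arg_of_ne hcfg (case5_D_not_x hS hcfg _),
    if_neg (case5_arg_D_rev_ne_G hS hcfg)]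

/-- The replacement node of the elimination of `D` is a constant or the pull-back of the other
wire of `D`. [folklore] -/
theorem case5E₂_repl_cases : (∃ b, (case5E₂ hf hd hF hC hS hcfg hφ hI αQ).repl = .const b) ∨
    (case5E₂ hf hd hF hC hS hcfg hφ hI αQ).repl = (case5E₁ hf hd hF hC hS hcfg hφ hI αQ).pull (C.arg D aD.rev) := by
  rcases (case5E₂ hf hd hF hC hS hcfg hφ hI αQ).repl_cases with h | ⟨a, ha⟩
  · exact Or.inl h
  · rcases fin2_eq_or_eq_rev aD a with e | e
    · rw [e, case5_arg_kD] at ha; exact Or.inl ⟨_, ha.symm⟩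
    · rw [e, case5_arg_kD_rev] at ha; exact Or.inr ha.symm

/-- The replacement node of the elimination of `D` is not `y`. [folklore] -/
theorem case5E₂_repl_ne_y : (case5E₂ hf hd hF hC hS hcfg hφ hI αQ).repl ≠ .var y := by
  intro h
  rcases case5E₂_repl_cases hf hd hF hC hS hcfg hφ hI αQ with ⟨b, hb⟩ | hr
  · rw [hb] at h; cases h
  · rw [hr] at h
    have := congrArg (case5E₁ hf hd hF hC hS hcfg hφ hI αQ).embed h
    rw [(case5E₁ hf hd hF hC hS hcfg hφ hI αQ).embed_pull (case5_arg_D_rev_ne_G (C := C) hS hcfg)] at this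
    exact case5_D_not_y hS hcfg aD.rev this

/-- After the elimination of `D`, `y` is a `≤ 1`-variable. [folklore] -/
theorem case5_fanout_y₂ : (case5E₂ hf hd hF hC hS hcfg hφ hI αQ).C'.fanout (.var y) ≤ 1 := by
  have h1 := (case5E₂ hf hd hF hC hS hcfg hφ hI αQ).fanout_var_add (i := y) (case5E₂_repl_ne_y hf hd hF hC hS hcfg hφ hI αQ)
  have h2 := case5_fanout_y₁ hf hd hF hC hS hcfg hφ hI αQ
  omega

include hcfg in
/-- When `B ≠ C'`, `B` does not read `y` (the readers of `y` are `G` and `C'`). [folklore] -/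
theorem case5_B_not_y (hBC : B ≠ C') (a : Fin 2) : C.arg B a ≠ .var y := by
  classical
  intro hBy
  have h3 : ({G, B, C'} : Finset (Fin C.m)) ⊆ univ := subset_univ _
  have hnot : G ∉ ({B, C'} : Finset (Fin C.m)) := by
    rw [mem_insert, mem_singleton, not_or]; exact ⟨hcfg.B_ne_G.symm, hcfg.C_ne_G.symm⟩
  have := sum_le_sum_of_subset_of_nonneg h3 (f := fun k => (univ.filter fun a : Fin 2 => C.arg k a = Node.var y).card)
    (fun _ _ _ => Nat.zero_le _)
  rw [sum_insert hnot, sum_pair hBC] at this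
  have hG1 : 1 ≤ (univ.filter fun a : Fin 2 => C.arg G a = .var y).card :=
    card_pos.mpr ⟨aX.rev, mem_filter.mpr ⟨mem_univ _, hcfg.arg_G_y⟩⟩
  have hB1 : 1 ≤ (univ.filter fun a : Fin 2 => C.arg B a = .var y).card :=
    card_pos.mpr ⟨a, mem_filter.mpr ⟨mem_univ _, hBy⟩⟩
  have hC1 : 1 ≤ (univ.filter fun a : Fin 2 => C.arg C' a = .var y).card :=
    card_pos.mpr ⟨aC, mem_filter.mpr ⟨mem_univ _, hcfg.arg_C⟩⟩
  have hfan := hcfg.fanout_y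
  unfold fanout at hfan
  omega

/-- The other wire of `B` after the eliminations of `G` and `D` is not `y` (when `B ≠ C'`). [folklore] -/
theorem case5_arg_kB_rev_ne_y (hBC : B ≠ C') :
    (case5E₂ hf hd hF hC hS hcfg hφ hI αQ).C'.arg (case5kB hf hd hF hC hS hcfg hφ hI αQ) aB.rev ≠ .var y := by
  intro h
  rw [(case5E₂ hf hd hF hC hS hcfg hφ hI αQ).arg_eq_var_iff, case5kB_spec] at h
  rcases h with h | h
  · rw [(case5E₁ hf hd hF hC hS hcfg hφ hI αQ).arg_eq_var_iff, case5kB₁_spec] at h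
    rcases h with h | h
    · rw [case5C₁_arg] at h
      cases hv : C.arg B aB.rev with
      | const c => rw [hv] at h; cases h
      | var i =>
        rw [hv] at h
        by_cases hix : i = x
        · rw [hix, Node.substConst_var_self] at h; cases h
        · rw [Node.substConst_var_of_ne hix] at h
          have hiy : i = y := Node.var.inj h
          rw [hiy] at hv
          exact case5_B_not_y hcfg hBC aB.rev hv
      | gate g => rw [hv] at h; cases h
    · have h2 := h.2; rw [case5E₁_repl] at h2; cases h2
  · exact case5E₂_repl_ne_y hf hd hF hC hS hcfg hφ hI αQ h.2

/-- After the elimination of `B`, `y` is a `≤ 1`-variable (when `B ≠ C'`). [folklore] -/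
theorem case5_fanout_y₃ (hBC : B ≠ C') : (case5E₃ hf hd hF hC hS hcfg hφ hI αQ).C'.fanout (.var y) ≤ 1 := by
  have hrepl : (case5E₃ hf hd hF hC hS hcfg hφ hI αQ).repl ≠ .var y := by
    intro h
    rcases (case5E₃ hf hd hF hC hS hcfg hφ hI αQ).repl_cases with ⟨b, hb⟩ | ⟨a, ha⟩
    · rw [hb] at h; cases h
    · rw [h] at ha
      rcases fin2_eq_or_eq_rev aB a with e | e
      · rw [e, case5_arg_kB] at ha; cases ha
      · rw [e] at ha; exact case5_arg_kB_rev_ne_y hf hd hF hC hS hcfg hφ hI αQ hBC ha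
  have h1 := (case5E₃ hf hd hF hC hS hcfg hφ hI αQ).fanout_var_add (i := y) hrepl
  have h2 := case5_fanout_y₂ hf hd hF hC hS hcfg hφ hI αQ
  omega

/-- **Gates reading `y` are not troubled after the elimination of `D`.** [folklore] -/
theorem case5_not_troubled_of_reads_y₂ {T : Fin (case5E₂ hf hd hF hC hS hcfg hφ hI αQ).C'.m} {a : Fin 2}
    (h : (case5E₂ hf hd hF hC hS hcfg hφ hI αQ).C'.arg T a = .var y) : ¬ (case5E₂ hf hd hF hC hS hcfg hφ hI αQ).C'.Troubled T := by
  rintro ⟨-, -, x', y', -, hr, hx', hy'⟩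
  have hmem : (Node.var y : Node n _) ∈ Set.range ((case5E₂ hf hd hF hC hS hcfg hφ hI αQ).C'.arg T) := ⟨a, h⟩
  rw [hr] at hmem
  have := case5_fanout_y₂ hf hd hF hC hS hcfg hφ hI αQ
  rcases hmem with h' | h'
  · cases h'; omega
  · cases h'; omega

/-- **Gates reading `y` are not troubled after the elimination of `B`** (`B ≠ C'`). [folklore] -/
theorem case5_not_troubled_of_reads_y₃ (hBC : B ≠ C') {T : Fin (case5E₃ hf hd hF hC hS hcfg hφ hI αQ).C'.m} {a : Fin 2}
    (h : (case5E₃ hf hd hF hC hS hcfg hφ hI αQ).C'.arg T a = .var y) : ¬ (case5E₃ hf hd hF hC hS hcfg hφ hI αQ).C'.Troubled T := by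
  rintro ⟨-, -, x', y', -, hr, hx', hy'⟩
  have hmem : (Node.var y : Node n _) ∈ Set.range ((case5E₃ hf hd hF hC hS hcfg hφ hI αQ).C'.arg T) := ⟨a, h⟩
  rw [hr] at hmem
  have := case5_fanout_y₃ hf hd hF hC hS hcfg hφ hI αQ hBC
  rcases hmem with h' | h'
  · cases h'; omega
  · cases h'; omega

/-! #### The success criterion -/

include hf hd hF hC hS hcfg hφ hI in
/-- **The main strategy of Case 5** (global form): if every troubled gate after the three
eliminations was troubled after `x := b`, then `Δμ ≥ 3 + α_φ + α_I ≥ δ` (three gates, the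
influential variable `x`, and the destroyed troubled gate `G`; empty packings throughout), one
substitution. [cite: LiYang2022, §4.1 (Case 5)] -/
theorem case5_main'
    (hT : ∀ T, (case5E₃ hf hd hF hC hS hcfg hφ hI αQ).C'.Troubled T →
      (case5C₁ hcfg).Troubled ((case5E₁ hf hd hF hC hS hcfg hφ hI αQ).ι ((case5E₂ hf hd hF hC hS hcfg hφ hI αQ).ι
        ((case5E₃ hf hd hF hC hS hcfg hφ hI αQ).ι T)))) :
    C.StepGoal f R αφ αI αQ := by
  classical
  set E₁ := case5E₁ hf hd hF hC hS hcfg hφ hI αQ with hE₁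
  set E₂ := case5E₂ hf hd hF hC hS hcfg hφ hI αQ with hE₂
  set E₃ := case5E₃ hf hd hF hC hS hcfg hφ hI αQ with hE₃
  have hx := case5_free_x hC hcfg
  have hxp := case5_unprot_x hS hcfg
  -- troubled gates inject into the troubled gates of `C₁`, which lost `G`
  have hpot : (E₃.C'.troubledCount : ℝ) + 1 ≤ C.troubledCount := by
    unfold troubledCount
    set T₃ := univ.filter fun k => E₃.C'.Troubled k with hT₃
    set T₀ := univ.filter fun k => C.Troubled k with hT₀
    have hGT : G ∈ T₀ := by rw [hT₀, mem_filter]; exact ⟨mem_univ _, hcfg.troubled⟩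
    let φ : Fin E₃.C'.m → Fin C.m := fun T => E₁.ι (E₂.ι (E₃.ι T))
    have hinj : Set.InjOn φ T₃ := fun a _ b _ h => E₃.ι_injective (E₂.ι_injective (E₁.ι_injective h))
    have hmaps : ∀ T ∈ T₃, φ T ∈ T₀.erase G := by
      intro T hTm
      rw [hT₃, mem_filter] at hTm
      have h1 := hT T hTm.2
      rw [mem_erase, hT₀, mem_filter]
      refine ⟨fun hG => ?_, mem_univ _, troubled_of_troubled_substConst (C := C) h1⟩
      change (case5C₁ hcfg).Troubled (φ T) at h1
      rw [hG] at h1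
      exact not_troubled_of_reads_const (case5C₁_arg_G hcfg) h1
    have h1 := card_le_card_of_injOn φ hmaps hinj
    rw [card_erase_of_mem hGT] at h1
    have h2 := card_pos.mpr ⟨G, hGT⟩
    have : T₃.card + 1 ≤ T₀.card := by omega
    exact_mod_cast this
  -- influential inputs
  have hxinf : x ∈ C.influential R := C.mem_influential_of_reads R hcfg.arg_G_x
  have hinf₁ : (((case5C₁ hcfg).influential (case5R₁ hC hS hcfg)).card : ℝ) + 1 ≤ (C.influential R).card := by
    have h1 := card_le_card (C.influential_substConst_assignFree_subset hx hxp (case5c hcfg) (finTwoEquiv (case5c hcfg)))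
    have h3 := card_erase_of_mem hxinf
    have h4 := card_pos.mpr ⟨x, hxinf⟩
    have : ((case5C₁ hcfg).influential (case5R₁ hC hS hcfg)).card + 1 ≤ (C.influential R).card := by
      change ((C.substConst x (finTwoEquiv (case5c hcfg))).influential (R.assignFree x (case5c hcfg) hx hxp)).card + 1 ≤ _
      omega
    exact_mod_cast this
  have hinf₃ : ((E₃.C'.influential (case5R₁ hC hS hcfg)).card : ℝ) ≤ ((case5C₁ hcfg).influential (case5R₁ hC hS hcfg)).card := by
    have h1 := E₃.influential_subset (case5R₁ hC hS hcfg)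
    have h2 := E₂.influential_subset (case5R₁ hC hS hcfg)
    have h3 := E₁.influential_subset (case5R₁ hC hS hcfg)
    exact_mod_cast card_le_card (h1.trans (h2.trans h3))
  -- gates
  have hm : (E₃.C'.m : ℝ) + 3 = C.m := by
    have h1 : E₁.C'.m + 1 = C.m := E₁.m_add_one
    have h2 : E₂.C'.m + 1 = E₁.C'.m := E₂.m_add_one
    have h3 : E₃.C'.m + 1 = E₂.C'.m := E₃.m_add_one
    have : E₃.C'.m + 3 = C.m := by omega
    exact_mod_cast this
  have hq : ((case5R₁ hC hS hcfg).quadCount : ℝ) = R.quadCount := by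
    show ((R.assignFree x (case5c hcfg) hx hxp).quadCount : ℝ) = _
    rw [RdqSource.quadCount_assignFree]
  have hdim : (case5R₁ hC hS hcfg).dim + 1 = R.dim := RdqSource.dim_assignFree hx hxp
  -- assemble with the empty packing
  refine Or.inr ⟨1, le_rfl, by norm_num, E₃.C', case5R₁ hC hS hcfg, ∅, E₃.fair, E₃.computes, E₃.C'.isPacking_empty, hdim, ?_⟩
  rw [Nat.cast_one, mul_one]
  have hδ := liYangDelta_le_three αφ αI αQ
  unfold measure potential
  rw [hq]
  simp only [card_empty, Nat.cast_zero, sub_zero]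
  nlinarith [mul_le_mul_of_nonneg_left hinf₁ hI, mul_le_mul_of_nonneg_left hinf₃ hI, mul_le_mul_of_nonneg_left hpot hφ]

include hf hd hF hC hS hcfg hφ hI in
/-- **The main strategy of Case 5** (stepwise form): if the eliminations of `D` and of `B`
introduce no troubled gate, then `Δμ ≥ 3 + α_φ + α_I ≥ δ`. [cite: LiYang2022, §4.1 (Case 5)] -/
theorem case5_main
    (h₂ : ∀ T, (case5E₂ hf hd hF hC hS hcfg hφ hI αQ).C'.Troubled T →
      (case5E₁ hf hd hF hC hS hcfg hφ hI αQ).C'.Troubled ((case5E₂ hf hd hF hC hS hcfg hφ hI αQ).ι T))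
    (h₃ : ∀ T, (case5E₃ hf hd hF hC hS hcfg hφ hI αQ).C'.Troubled T →
      (case5E₂ hf hd hF hC hS hcfg hφ hI αQ).C'.Troubled ((case5E₃ hf hd hF hC hS hcfg hφ hI αQ).ι T)) :
    C.StepGoal f R αφ αI αQ :=
  case5_main' hf hd hF hC hS hcfg hφ hI αQ fun T hT =>
    case5E₁_noNew hf hd hF hC hS hcfg hφ hI αQ _ (h₂ _ (h₃ T hT))

end Chain

end Semicircuit

end Literature.Computability.Complexity
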